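import Literature.MathematicalPhysics.QuantumLattice.RectTorusInteractionBounds
import Literature.MathematicalPhysics.QuantumLattice.SpinChargeTransportRate
import Literature.MathematicalPhysics.QuantumLattice.HubbardLSMFillingAssembly
import Literature.MathematicalPhysics.QuantumLattice.FinDimSpectrumSpectralGapProofs
import Mathlib.Analysis.SpecialFunctions.Exponential
import HarnessLib

/-!
# Higher-dimensional Lieb–Schultz–Mattis (`higherDim_lsm`): the even-length half and the discharge

Sibling proof file of `SpinChains.lean` (theorems only, no definitions, no named facts). It proves
the even-length case of the two-dimensional Lieb–Schultz–Mattis theorem of Nachtergaele–Sims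
(Comm. Math. Phys. **276** (2007) 437, Thm 1.1; Hastings, PRB **69** (2004) 104431) in the form
isolated by `HigherDimLSM.higherDim_lsm_of_even_case` (`SpinChainsHigherDimLsmParityProofs.lean`),
and hence the named fact `higherDim_lsm` (`higherDim_lsm_holds`).

The argument is Hastings' (2004): for a finite-range, bounded, Hermitian, translation- and
rotation-invariant spin-`1/2` interaction `Φ` on `ℤ²`, the torus `ℤ/L × ℤ/W` model satisfies the
hypotheses of the spin Lieb–Schultz–Mattis index machinery (`RectTorusInteractionBounds.lean`:
coordinate locality uniformly in `L, W`, `U(1)` symmetry of the terms, translation symmetry), so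
for a unique ground state with gap `γ` the index theorem in the regime `a = g/L`, `g = min γ 1`
(`SpinChargeTransportRate.exists_int_abs_sub_le_of_regime`, Bachmann–Bols–De Roeck–Fraas 2019
Thm 2.1 with Hastings' Gaussian dressing) gives
`dist(ρ₀, ℤ) ≤ K (LW)² L² g⁻² e^{-κ g L/2}`, `ρ₀ = ⟨ψ, Q_{column 0} ψ⟩`. Translation invariance and
`Sᶻ_tot ψ = 0` (`SU(2)` + uniqueness) give `ρ₀ = W/2` (`expect_column_eq`), so for odd `W`
`dist(ρ₀, ℤ) = 1/2` and `e^{κ g L/2} ≤ 2K L⁸ g⁻²`; elementary analysis (`gap_le_of_exp_le`) then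
yields `γ ≤ C₀ log L / L` for `L ≥ L₀`, with `L₀, C₀` depending on `Φ` only through
`(⌊R⌋, J)` — Nachtergaele–Sims' `C log L / L` bound (their Thm 1.1, even `L`).

## References

* B. Nachtergaele, R. Sims, *A multi-dimensional Lieb–Schultz–Mattis theorem*, Comm. Math.
  Phys. **276** (2007) 437–472, Theorem 1.1 and §1.5. [NachtergaeleSimsCMP2007]
* M. B. Hastings, *Lieb–Schultz–Mattis in higher dimensions*, Phys. Rev. B **69** (2004) 104431,
  §§II–IV. [HastingsPRB2004]
* S. Bachmann, A. Bols, W. De Roeck, M. Fraas, *A many-body index for quantum charge transport*,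
  Comm. Math. Phys. **375** (2019) 1249–1272, Thm 2.1, Prop. 2.4, §3.2. [BachmannEtAl2019]
-/

noncomputable section

namespace Literature.MathematicalPhysics.QuantumLattice

open Matrix Complex Finset SpinLSM
open scoped Matrix.Norms.L2Operator ComplexOrder
open Literature.Probability.LatticeModels

namespace HigherDimLSM

/-! ### Spectral preliminaries -/

section Spectral

variable {n : Type*} [Fintype n] [DecidableEq n]

/-- **A unique ground state is gapped by its numerical gap**: for Hermitian `A` with
`dim ker (A - E₀) = 1`, every `0 < Δ ≤ spectralGap A` is a spectral gap in the sense of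
`HasSpectralGap` (all eigenvalues other than `E₀` are `≥ inf (σ(A) ∖ {E₀}) = E₀ + spectralGap A`).
Tasaki (2020) §2.1; Reed–Simon IV §XIII.1. [folklore] -/
theorem hasSpectralGap_of_le_spectralGap {A : Matrix n n ℂ} (hA : A.IsHermitian)
    (hU : A.HasUniqueGroundState) {Δ : ℝ} (hΔ : 0 < Δ) (hle : Δ ≤ A.spectralGap) :
    A.HasSpectralGap Δ := by
  classical
  refine (hA.hasSpectralGap_iff_card_filter Δ).2 ⟨hΔ, ?_, ?_⟩
  · rw [hA.card_filter_eigenvalues_eq]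
    exact hU
  · rintro _ ⟨i, rfl⟩
    by_cases hi : hA.eigenvalues i = A.groundEnergy
    · exact Or.inl hi
    · refine Or.inr (Set.mem_Ici.2 ?_)
      set S : Set ℝ := (RCLike.re '' spectrum ℂ (toEuclideanCLM (n := n) (𝕜 := ℂ) A)) \ {A.groundEnergy}
        with hSdef
      have hS : hA.eigenvalues i ∈ S := by
        refine ⟨?_, hi⟩
        rw [hA.re_image_spectrum_toEuclideanCLM]
        exact ⟨i, rfl⟩
      have hfin : S.Finite :=
        (Set.finite_range hA.eigenvalues).subset (by
          rw [hSdef, ← hA.re_image_spectrum_toEuclideanCLM]; exact Set.sdiff_subset)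
      have hinf : sInf S ≤ hA.eigenvalues i := csInf_le hfin.bddBelow hS
      have hgap : A.spectralGap = sInf S - A.groundEnergy := rfl
      linarith

/-- A Hermitian matrix on a nonempty index type has a normalised ground-state vector.
Tasaki (2020) §2.1. [folklore] -/
theorem exists_unit_isGroundStateVector {A : Matrix n n ℂ} (hA : A.IsHermitian) [Nonempty n] :
    ∃ ψ : n → ℂ, A.IsGroundStateVector ψ ∧ star ψ ⬝ᵥ ψ = 1 := by
  obtain ⟨ψ, hψ, hψ0⟩ := (Submodule.ne_bot_iff _).1 (groundSpace_ne_bot_holds hA)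
  have hgs : A.IsGroundStateVector ψ := (isGroundStateVector_iff A ψ).2 ⟨hψ0, hψ⟩
  obtain ⟨ψ₁, h₁, -, h₁1⟩ := exists_unit_groundStateVector hgs (K := ⊤) Submodule.mem_top
  exact ⟨ψ₁, h₁, h₁1⟩

end Spectral

/-! ### The torus model satisfies the hypotheses of the index machinery -/

section Model

variable (Ls : Fin 2 → ℕ) [∀ i, NeZero (Ls i)]

omit [∀ i, NeZero (Ls i)] in
/-- The projection of the unit vector `e₀` of `ℤ²` is the unit vector of the torus. [folklore] -/
theorem proj_single_zero_one :
    RectTorus.proj Ls (Pi.single (0 : Fin 2) (1 : ℤ)) = Pi.single (0 : Fin 2) 1 := by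
  funext j
  rw [RectTorus.proj_apply]
  by_cases hj : j = 0
  · subst hj; simp
  · simp [hj]

/-- The torus `Π i, ℤ/(Ls i)` (`d = 2`) has `Ls 0 · Ls 1` sites. [folklore] -/
theorem card_rectTorusSite_two : Fintype.card (RectTorusSite Ls) = Ls 0 * Ls 1 := by
  rw [card_rectTorusSite, Fin.prod_univ_two]

/-- **The setting of the index argument on the torus.** For an admissible interaction, a spectral
gap `g > 0` of the torus Hamiltonian with normalised ground-state vector `ψ`, and `Ls 0 ≥ rateL0`,
the data (coordinate `x ↦ x₀`, unit translation in direction `0`, torus interaction, range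
`⌊R⌋ + 1`, term size `(2⌊R⌋+1)²`, strength `4 · 2^{(2⌊R⌋+1)²} J`, Gaussian rate `g / L`, scales
`L/2, L/8, L/16`) form a `SpinLSM.Setting`. Nachtergaele–Sims (2007) §1.2 (LSM1–LSM3);
Bachmann et al. (2019) §2.1. [folklore] -/
theorem setting_rectTorus {Φ : LatticeInteraction 2 2} {R J : ℝ} (hR : Φ.HasFiniteRange R)
    (hJ : Φ.IsBounded J) (hH : Φ.IsHermitian) (hT : Φ.IsTranslationInvariant)
    (hrot : Φ.IsRotationInvariant) {g : ℝ} (hg : 0 < g)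
    (hgap : (rectTorusHamiltonian Φ Ls).HasSpectralGap g) {ψ : TensorIndex (RectTorusSite Ls) 2 → ℂ}
    (hψ : (rectTorusHamiltonian Φ Ls).IsGroundStateVector ψ) (hψ1 : star ψ ⬝ᵥ ψ = 1)
    (hL : rateL0 (⌊R⌋₊ + 1) ((2 * ⌊R⌋₊ + 1) ^ 2) (2 ^ 2 * 2 ^ ((2 * ⌊R⌋₊ + 1) ^ 2) * J) ≤ Ls 0) :
    SpinLSM.Setting (fun x : RectTorusSite Ls => x 0) (Equiv.addRight (Pi.single 0 1))
      (rectTorusInteraction Φ Ls) (⌊R⌋₊ + 1) ((2 * ⌊R⌋₊ + 1) ^ 2)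
      (2 ^ 2 * 2 ^ ((2 * ⌊R⌋₊ + 1) ^ 2) * J) (g / Ls 0) (Ls 0 / 2) (Ls 0 / 8) (Ls 0 / 16) g ψ := by
  have h64 := (regime_basic hL).1
  have hL0 : (0 : ℝ) < Ls 0 := by exact_mod_cast (show 0 < Ls 0 by omega)
  have hsymm := permOp_addRight_mul_rectTorusHamiltonian Ls hT (Pi.single 0 1)
  rw [proj_single_zero_one] at hsymm
  exact
    { coordLocal := isCoordLocal_rectTorusInteraction Ls hR hJ hH 0
      u1 := commute_rectTorusInteraction_regionCharge Ls hrot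
      shift := fun x => by simp
      surj := fun c => ⟨Pi.single 0 c, by simp⟩
      symm := hsymm
      a_pos := div_pos hg hL0
      gap_pos := hg
      gap := hgap
      ground := hψ
      unit := hψ1
      one_le_r₀ := Nat.succ_pos _
      r₀_le_r := by omega
      r_le_m := by omega
      h_ge := by omega
      h_le := by omega }

/-- The translate of the column `{x₀ = c}` by the unit translation is the column `{x₀ = c + 1}`.
[folklore] -/
theorem map_addRight_column (c : ZMod (Ls 0)) :
    ((univ : Finset (RectTorusSite Ls)).filter (fun x => x 0 = c)).map
        (Equiv.addRight (Pi.single (0 : Fin 2) (1 : ZMod (Ls 0)) : RectTorusSite Ls)).toEmbedding =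
      (univ : Finset (RectTorusSite Ls)).filter (fun x => x 0 = c + 1) := by
  ext y
  simp only [Finset.mem_map_equiv, Finset.mem_filter, Finset.mem_univ, true_and,
    Equiv.addRight_symm, Equiv.coe_addRight, Pi.add_apply, Pi.neg_apply, Pi.single_eq_same]
  constructor
  · intro h; rw [← h]; abel
  · intro h; rw [h]; abel

/-- The plane `cslab (· 0) (zrange 0 1)` of the index machinery is the column `{x₀ = 0}`.
[folklore] -/
theorem cslab_zrange_zero_one :
    cslab (fun x : RectTorusSite Ls => x 0) (zrange 0 1) =
      (univ : Finset (RectTorusSite Ls)).filter (fun x => x 0 = 0) := by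
  ext x
  simp only [mem_cslab, mem_zrange, Finset.mem_filter, Finset.mem_univ, true_and]
  constructor
  · rintro ⟨k, hk, h⟩
    have : k = 0 := by omega
    subst this
    simpa using h
  · intro h
    exact ⟨0, Nat.one_pos, by simpa using h⟩

/-- **The ground-state charge of a column is `W/2`.** For a rotation- and translation-invariant
admissible interaction with a unique gapped ground state `ψ` (normalised) on the torus
`ℤ/L × ℤ/W`: all columns `{x₀ = c}` carry the same ground-state charge (translation symmetry,
`V ψ = λ ψ`), their sum is `⟨ψ, Q_Λ ψ⟩ = LW/2` (`Sᶻ_tot ψ = 0`), hence each is `W/2`.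
Hastings (2004) §II; Nachtergaele–Sims (2007) §1.5. [folklore] -/
theorem expect_column_eq {Φ : LatticeInteraction 2 2} (hT : Φ.IsTranslationInvariant)
    (hrot : Φ.IsRotationInvariant) {g : ℝ} (hgap : (rectTorusHamiltonian Φ Ls).HasSpectralGap g)
    (hU : (rectTorusHamiltonian Φ Ls).HasUniqueGroundState)
    {ψ : TensorIndex (RectTorusSite Ls) 2 → ℂ} (hψ : (rectTorusHamiltonian Φ Ls).IsGroundStateVector ψ)
    (hψ1 : star ψ ⬝ᵥ ψ = 1) :
    star ψ ⬝ᵥ (regionCharge (cslab (fun x : RectTorusSite Ls => x 0) (zrange 0 1)) *ᵥ ψ) =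
      ((Ls 1 : ℕ) : ℂ) / 2 := by
  -- the columns and their charges
  set e : ZMod (Ls 0) → ℂ := fun c =>
    star ψ ⬝ᵥ (regionCharge ((univ : Finset (RectTorusSite Ls)).filter (fun x => x 0 = c)) *ᵥ ψ)
    with he
  -- translation symmetry: all columns carry the same charge
  have hsymm := permOp_addRight_mul_rectTorusHamiltonian Ls hT (Pi.single 0 1)
  rw [proj_single_zero_one] at hsymm
  have hstep : ∀ c : ZMod (Ls 0), e (c + 1) = e c := by
    intro c
    have h := (expect_permOp_conj hgap _ hsymm hψ
      (regionCharge ((univ : Finset (RectTorusSite Ls)).filter (fun x => x 0 = c)))).1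
    rw [permOp_mul_regionCharge_mul_conjTranspose, map_addRight_column] at h
    exact h
  have hall : ∀ c : ZMod (Ls 0), e c = e 0 := by
    have hnat : ∀ k : ℕ, e (k : ZMod (Ls 0)) = e 0 := by
      intro k
      induction k with
      | zero => rw [Nat.cast_zero]
      | succ k ih => rw [Nat.cast_succ, hstep, ih]
    intro c
    rw [← ZMod.natCast_zmod_val c]
    exact hnat _
  -- the total charge
  have hsum : ∑ c : ZMod (Ls 0), e c =
      star ψ ⬝ᵥ (regionCharge (univ : Finset (RectTorusSite Ls)) *ᵥ ψ) := by
    have hQ : regionCharge (univ : Finset (RectTorusSite Ls)) =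
        ∑ c : ZMod (Ls 0), regionCharge ((univ : Finset (RectTorusSite Ls)).filter (fun x => x 0 = c)) := by
      unfold regionCharge
      exact (Finset.sum_fiberwise univ (fun x : RectTorusSite Ls => x 0) upCharge).symm
    rw [hQ, Matrix.sum_mulVec, dotProduct_sum]
  have htot : star ψ ⬝ᵥ (regionCharge (univ : Finset (RectTorusSite Ls)) *ᵥ ψ) =
      ((Ls 0 * Ls 1 : ℕ) : ℂ) / 2 := by
    rw [expect_regionCharge_univ_of_hasUniqueGroundState
      (fun α => commute_rectTorusHamiltonian_totalSpin hrot Ls α) hU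
      ((isGroundStateVector_iff _ _).1 hψ).2, hψ1, mul_one, card_rectTorusSite_two]
  -- conclude
  have hL0 : ((Ls 0 : ℕ) : ℂ) ≠ 0 := by exact_mod_cast NeZero.ne (Ls 0)
  have hconst : ∑ c : ZMod (Ls 0), e c = (Ls 0 : ℂ) * e 0 := by
    rw [Finset.sum_congr rfl fun c _ => hall c, Finset.sum_const, Finset.card_univ, ZMod.card,
      nsmul_eq_mul]
  have h0 : e 0 = ((Ls 1 : ℕ) : ℂ) / 2 := by
    have h := hconst.symm.trans (hsum.trans htot)
    have h' : ((Ls 0 : ℕ) : ℂ) * e 0 = ((Ls 0 : ℕ) : ℂ) * (((Ls 1 : ℕ) : ℂ) / 2) := by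
      rw [h]; push_cast; ring
    exact mul_left_cancel₀ hL0 h'
  rw [cslab_zrange_zero_one]
  exact h0

end Model

/-! ### Elementary analysis of the final inequality -/

section Analysis

/-- `dist(W/2, ℤ) ≥ 1/2` for odd `W`. [folklore] -/
theorem half_le_abs_half_sub_int {W : ℕ} (hW : Odd W) (n : ℤ) : (1 : ℝ) / 2 ≤ |(W : ℝ) / 2 - n| := by
  obtain ⟨k, rfl⟩ := hW
  have h : ((2 * k + 1 : ℕ) : ℝ) / 2 - n = ((k : ℤ) - n : ℤ) + 1 / 2 := by push_cast; ring
  rw [h]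
  rcases le_or_gt 0 ((k : ℤ) - n) with hm | hm
  · have : (0 : ℝ) ≤ ((k : ℤ) - n : ℤ) := by exact_mod_cast hm
    rw [abs_of_nonneg (by linarith)]
    linarith
  · have : (((k : ℤ) - n : ℤ) : ℝ) ≤ -1 := by exact_mod_cast (show (k : ℤ) - n ≤ -1 by omega)
    rw [abs_of_neg (by linarith)]
    linarith

/-- **The endgame.** If `e^{κ g L/2} ≤ 2K L⁸ / g²` with `g = min γ 1`, `log L / L < γ`,
`L ≥ 3` and `L > 9!·2K·(2/κ)⁹`, then `γ ≤ (2/κ)(|log 2K|/log 2 + 10) · log L / L`.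
(For `γ ≥ 1` the hypothesis is contradictory by `e^x ≥ x⁹/9!`; for `γ < 1`, `g = γ > 1/L` and one
takes logarithms.) Nachtergaele–Sims (2007) §1.3 (choice `a = γ/L`, conclusion `γ L ≤ C log L`).
[folklore] -/
theorem gap_le_of_exp_le {κ K γ Lr : ℝ} (hκ : 0 < κ) (hK : 0 < K) (hL3 : 3 ≤ Lr)
    (hbig : (Nat.factorial 9 : ℝ) * (2 * K) * (2 / κ) ^ 9 < Lr) (hγ : Real.log Lr / Lr < γ)
    (h : Real.exp (κ * min γ 1 * Lr / 2) ≤ 2 * K * Lr ^ 8 / (min γ 1) ^ 2) :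
    γ ≤ 2 / κ * (|Real.log (2 * K)| / Real.log 2 + 10) * Real.log Lr / Lr := by
  have hL0 : 0 < Lr := by linarith
  have hlog1 : 1 ≤ Real.log Lr := by
    have h3 : Real.exp 1 < 3 := lt_trans Real.exp_one_lt_d9 (by norm_num)
    have := Real.log_le_log (Real.exp_pos 1) (h3.le.trans hL3)
    rwa [Real.log_exp] at this
  have hlog2 : Real.log 2 ≤ Real.log Lr := Real.log_le_log two_pos (by linarith)
  have hlog2pos : 0 < Real.log 2 := Real.log_pos one_lt_two
  rcases le_or_gt 1 γ with hγ1 | hγ1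
  · -- `γ ≥ 1`: contradiction
    exfalso
    rw [min_eq_right hγ1] at h
    have hx : 0 ≤ κ * 1 * Lr / 2 := by positivity
    have hpow := Real.pow_div_factorial_le_exp _ hx 9
    have h1 : (κ * 1 * Lr / 2) ^ 9 / (Nat.factorial 9 : ℝ) ≤ 2 * K * Lr ^ 8 / 1 ^ 2 := hpow.trans h
    rw [one_pow, div_one, div_le_iff₀ (by positivity)] at h1
    -- `(κ/2)^9 L^9 ≤ 9!·2K·L^8` forces `L ≤ 9!·2K·(2/κ)^9`
    have h2 : Lr ≤ (Nat.factorial 9 : ℝ) * (2 * K) * (2 / κ) ^ 9 := by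
      have e1 : (κ * 1 * Lr / 2) ^ 9 = (κ / 2) ^ 9 * Lr ^ 8 * Lr := by ring
      rw [e1] at h1
      have hk9 : (0 : ℝ) < (κ / 2) ^ 9 := by positivity
      have hL8 : (0 : ℝ) < Lr ^ 8 := by positivity
      have h3 : (κ / 2) ^ 9 * Lr ≤ 2 * K * (Nat.factorial 9 : ℝ) :=
        le_of_mul_le_mul_left (by linarith [h1]) hL8
      have e2 : (2 / κ) ^ 9 = 1 / (κ / 2) ^ 9 := by rw [div_pow, div_pow, one_div, inv_div]
      rw [e2]
      rw [show (Nat.factorial 9 : ℝ) * (2 * K) * (1 / (κ / 2) ^ 9) = 2 * K * (Nat.factorial 9 : ℝ) / (κ / 2) ^ 9 by ring,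
        le_div_iff₀ hk9]
      linarith
    linarith
  · -- `γ < 1`: take logarithms
    rw [min_eq_left hγ1.le] at h
    have hγ0 : 0 < γ := lt_of_le_of_lt (by positivity) hγ
    have hγL : 1 < γ * Lr := by
      have : Real.log Lr < γ * Lr := by rwa [div_lt_iff₀ hL0] at hγ
      linarith
    have hbound : Real.exp (κ * γ * Lr / 2) ≤ 2 * K * Lr ^ 10 := by
      refine h.trans ?_
      rw [div_le_iff₀ (by positivity)]
      have hsq : (1 : ℝ) ≤ (γ * Lr) ^ 2 := by nlinarith
      calc 2 * K * Lr ^ 8 = 2 * K * Lr ^ 8 * 1 := by ring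
        _ ≤ 2 * K * Lr ^ 8 * (γ * Lr) ^ 2 := by gcongr
        _ = 2 * K * Lr ^ 10 * γ ^ 2 := by ring
    have hlog := Real.log_le_log (Real.exp_pos _) hbound
    rw [Real.log_exp, Real.log_mul (by positivity) (by positivity), Real.log_pow] at hlog
    push_cast at hlog
    -- `|log 2K| ≤ (|log 2K| / log 2) log L`
    have habs : Real.log (2 * K) ≤ |Real.log (2 * K)| / Real.log 2 * Real.log Lr := by
      calc Real.log (2 * K) ≤ |Real.log (2 * K)| := le_abs_self _
        _ = |Real.log (2 * K)| / Real.log 2 * Real.log 2 := by field_simp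
        _ ≤ |Real.log (2 * K)| / Real.log 2 * Real.log Lr := by gcongr
    rw [le_div_iff₀ hL0]
    have hκ2 : κ * γ * Lr / 2 ≤ (|Real.log (2 * K)| / Real.log 2 + 10) * Real.log Lr := by linarith
    calc γ * Lr = 2 / κ * (κ * γ * Lr / 2) := by field_simp
      _ ≤ 2 / κ * ((|Real.log (2 * K)| / Real.log 2 + 10) * Real.log Lr) := by gcongr
      _ = 2 / κ * (|Real.log (2 * K)| / Real.log 2 + 10) * Real.log Lr := by ring

end Analysis

/-! ### The even-length case -/

section EvenCase

/-- `rateConst > 0`. [folklore] -/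
theorem rateConst_pos {r₀ V : ℕ} {J : ℝ} (hJ : 0 ≤ J) (hV : 1 ≤ V) : 0 < rateConst r₀ V J := by
  have h1 := two_le_rateKD (V := V) hJ
  have h2 := half_le_rateKX (r₀ := r₀) hJ hV
  unfold rateConst
  have : 0 < Real.sqrt (rateKX r₀ V J) := Real.sqrt_pos.2 (by linarith)
  exact mul_pos (mul_pos (by norm_num) (by linarith)) this

/-- **The even-length case of Nachtergaele–Sims' Theorem 1.1** (in the form required by
`higherDim_lsm_of_even_case`): for an admissible interaction there are `L₀` and `C₀` such that on
every torus `ℤ/L × ℤ/W` with `L ≥ L₀` even and `W ≤ L` odd, a unique ground state has gap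
`≤ C₀ log L / L`. Nachtergaele–Sims (2007) Thm 1.1; Hastings (2004).
[cite: NachtergaeleSimsCMP2007, Theorem 1.1] -/
theorem even_case (Φ : LatticeInteraction 2 2) (R J : ℝ) (hR : Φ.HasFiniteRange R)
    (hJ : Φ.IsBounded J) (hH : Φ.IsHermitian) (hT : Φ.IsTranslationInvariant)
    (hrot : Φ.IsRotationInvariant) :
    ∃ (L₀ : ℕ) (C₀ : ℝ), ∀ (L W : ℕ) [∀ i, NeZero (![L, W] i)], Even L → L₀ ≤ L → Odd W →
      W ≤ L → (rectTorusHamiltonian Φ ![L, W]).HasUniqueGroundState →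
        (rectTorusHamiltonian Φ ![L, W]).spectralGap ≤ C₀ * Real.log L / L := by
  -- the constants
  set r₀ : ℕ := ⌊R⌋₊ + 1 with hr₀
  set V : ℕ := (2 * ⌊R⌋₊ + 1) ^ 2 with hV
  set Jt : ℝ := 2 ^ 2 * 2 ^ ((2 * ⌊R⌋₊ + 1) ^ 2) * J with hJt
  have hJ0 : 0 ≤ J := (norm_nonneg _).trans (hJ ∅)
  have hJt0 : 0 ≤ Jt := by positivity
  have hV1 : 1 ≤ V := Nat.one_le_pow _ _ (by omega)
  set κ : ℝ := rateKappa r₀ V Jt with hκ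
  set K : ℝ := rateConst r₀ V Jt with hK
  have hκ0 : 0 < κ := rateKappa_pos hJt0 hV1
  have hK0 : 0 < K := rateConst_pos hJt0 hV1
  set L₀ : ℕ := max (rateL0 r₀ V Jt) (max 3 (⌈(Nat.factorial 9 : ℝ) * (2 * K) * (2 / κ) ^ 9⌉₊ + 1))
    with hL₀
  set C₀ : ℝ := max 1 (2 / κ * (|Real.log (2 * K)| / Real.log 2 + 10)) with hC₀
  refine ⟨L₀, C₀, fun L W _ _ hL₀L hW hWL hU => ?_⟩
  -- unpack `L ≥ L₀`
  have hL1 : rateL0 r₀ V Jt ≤ L := le_trans (le_max_left _ _) hL₀L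
  have hL3 : 3 ≤ L := le_trans ((le_max_left _ _).trans (le_max_right _ _)) hL₀L
  have hLbig : (Nat.factorial 9 : ℝ) * (2 * K) * (2 / κ) ^ 9 < L := by
    have h1 : ⌈(Nat.factorial 9 : ℝ) * (2 * K) * (2 / κ) ^ 9⌉₊ + 1 ≤ L :=
      le_trans ((le_max_right _ _).trans (le_max_right _ _)) hL₀L
    have h2 := Nat.le_ceil ((Nat.factorial 9 : ℝ) * (2 * K) * (2 / κ) ^ 9)
    have h3 : ((⌈(Nat.factorial 9 : ℝ) * (2 * K) * (2 / κ) ^ 9⌉₊ + 1 : ℕ) : ℝ) ≤ L := by exact_mod_cast h1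
    push_cast at h3
    linarith
  have hL3r : (3 : ℝ) ≤ L := by exact_mod_cast hL3
  have hLpos : (0 : ℝ) < L := by linarith
  have hlogpos : 0 < Real.log L := Real.log_pos (by linarith)
  -- suppose the gap were larger
  by_contra hcon
  rw [not_le] at hcon
  set H := rectTorusHamiltonian Φ ![L, W] with hHdef
  set γ : ℝ := H.spectralGap with hγdef
  have hγlog : Real.log L / L < γ := by
    refine lt_of_le_of_lt ?_ hcon
    rw [div_le_div_iff_of_pos_right hLpos]
    have : (1 : ℝ) ≤ C₀ := le_max_left _ _
    nlinarith
  have hγ0 : 0 < γ := lt_of_le_of_lt (by positivity) hγlog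
  -- the gap `g = min γ 1` and the ground state
  set g : ℝ := min γ 1 with hgdef
  have hg0 : 0 < g := lt_min hγ0 one_pos
  have hg1 : g ≤ 1 := min_le_right _ _
  have hHerm : H.IsHermitian := rectTorusHamiltonian_isHermitian' hH _
  have hgap : H.HasSpectralGap g := hasSpectralGap_of_le_spectralGap hHerm hU hg0 (min_le_left _ _)
  haveI : Nonempty (TensorIndex (RectTorusSite ![L, W]) 2) := ⟨fun _ => 0⟩
  obtain ⟨ψ, hψ, hψ1⟩ := exists_unit_isGroundStateVector hHerm
  -- the index theorem in the regime
  have hs := setting_rectTorus ![L, W] hR hJ hH hT hrot hg0 hgap hψ hψ1 hL1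
  obtain ⟨n, hn⟩ := exists_int_abs_sub_le_of_regime hs hg1 hL1
  rw [expect_column_eq ![L, W] hT hrot hgap hU hψ hψ1, card_rectTorusSite_two] at hn
  simp only [Matrix.cons_val_zero, Matrix.cons_val_one] at hn
  have hre : ((((W : ℕ) : ℂ) / 2).re : ℝ) = (W : ℝ) / 2 := by
    rw [show ((W : ℕ) : ℂ) / 2 = (((W : ℝ) / 2 : ℝ) : ℂ) by push_cast; ring]
    exact Complex.ofReal_re _
  rw [hre] at hn
  -- `1/2 ≤ K (LW)² L² g⁻² e^{-κ g L/2} ≤ K L⁸ g⁻² e^{-κ g L/2}`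
  have hhalf := (half_le_abs_half_sub_int hW n).trans hn
  have hWL' : (W : ℝ) ≤ L := by exact_mod_cast hWL
  have hexp : Real.exp (κ * g * L / 2) ≤ 2 * K * (L : ℝ) ^ 8 / g ^ 2 := by
    have hE := Real.exp_pos (-(κ * g * L / 2))
    have h1 : (1 : ℝ) / 2 ≤ K * (L : ℝ) ^ 8 / g ^ 2 * Real.exp (-(κ * g * L / 2)) := by
      refine hhalf.trans ?_
      have hcard : ((L * W : ℕ) : ℝ) ^ 2 * (L : ℝ) ^ 2 ≤ (L : ℝ) ^ 8 := by
        push_cast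
        have h1 : ((L : ℝ) * W) ^ 2 ≤ ((L : ℝ) * L) ^ 2 :=
          pow_le_pow_left₀ (by positivity) (mul_le_mul_of_nonneg_left hWL' hLpos.le) 2
        have hL1 : (1 : ℝ) ≤ L := by linarith
        calc ((L : ℝ) * W) ^ 2 * (L : ℝ) ^ 2 ≤ ((L : ℝ) * L) ^ 2 * (L : ℝ) ^ 2 :=
              mul_le_mul_of_nonneg_right h1 (by positivity)
          _ = (L : ℝ) ^ 6 := by ring
          _ ≤ (L : ℝ) ^ 8 := pow_le_pow_right₀ hL1 (by norm_num)
      calc K * ((L * W : ℕ) : ℝ) ^ 2 * (L : ℝ) ^ 2 / g ^ 2 * Real.exp (-(κ * g * L / 2))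
          = K / g ^ 2 * Real.exp (-(κ * g * L / 2)) * (((L * W : ℕ) : ℝ) ^ 2 * (L : ℝ) ^ 2) := by ring
        _ ≤ K / g ^ 2 * Real.exp (-(κ * g * L / 2)) * (L : ℝ) ^ 8 :=
            mul_le_mul_of_nonneg_left hcard (by positivity)
        _ = K * (L : ℝ) ^ 8 / g ^ 2 * Real.exp (-(κ * g * L / 2)) := by ring
    have h2 : Real.exp (κ * g * L / 2) * Real.exp (-(κ * g * L / 2)) = 1 := by
      rw [← Real.exp_add, add_neg_cancel, Real.exp_zero]
    have h3 : Real.exp (κ * g * L / 2) * (1 / 2) ≤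
        Real.exp (κ * g * L / 2) * (K * (L : ℝ) ^ 8 / g ^ 2 * Real.exp (-(κ * g * L / 2))) :=
      mul_le_mul_of_nonneg_left h1 (Real.exp_nonneg _)
    have h4 : Real.exp (κ * g * L / 2) * (K * (L : ℝ) ^ 8 / g ^ 2 * Real.exp (-(κ * g * L / 2))) =
        K * (L : ℝ) ^ 8 / g ^ 2 := by
      calc _ = K * (L : ℝ) ^ 8 / g ^ 2 * (Real.exp (κ * g * L / 2) * Real.exp (-(κ * g * L / 2))) := by ring
        _ = _ := by rw [h2, mul_one]
    rw [h4] at h3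
    have e5 : 2 * K * (L : ℝ) ^ 8 / g ^ 2 = 2 * (K * (L : ℝ) ^ 8 / g ^ 2) := by ring
    rw [e5]
    linarith
  -- the endgame
  have hmin : κ * min γ 1 * L / 2 = κ * g * L / 2 := by rw [hgdef]
  have hfinal := gap_le_of_exp_le hκ0 hK0 hL3r hLbig hγlog (by rw [hmin]; exact hexp)
  have hC : 2 / κ * (|Real.log (2 * K)| / Real.log 2 + 10) * Real.log L / L ≤ C₀ * Real.log L / L := by
    rw [div_le_div_iff_of_pos_right hLpos]
    exact mul_le_mul_of_nonneg_right (le_max_right _ _) hlogpos.le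
  linarith

end EvenCase

end HigherDimLSM

/-- **Discharge of the named fact `higherDim_lsm`** (Nachtergaele–Sims, Comm. Math. Phys. **276**
(2007) 437, Theorem 1.1; Hastings, Phys. Rev. B **69** (2004) 104431): odd `L` is vacuous
(Kramers/`SU(2)` degeneracy, `higherDim_lsm_of_even_case`), and for even `L ≥ L₀` the gap above a
unique ground state on `ℤ/L × ℤ/W`, `W ≤ L` odd, is `≤ C log L / L` (`HigherDimLSM.even_case`,
Hastings' argument in the Bachmann–Bols–De Roeck–Fraas index formulation with a Gaussian
quasi-adiabatic filter). [cite: NachtergaeleSimsCMP2007, Theorem 1.1] -/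
theorem higherDim_lsm_holds : higherDim_lsm :=
  HigherDimLSM.higherDim_lsm_of_even_case HigherDimLSM.even_case

end Literature.MathematicalPhysics.QuantumLattice

end
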